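import Summits.BirchSwinnertonDyer.BirchSwinnertonDyer.Theses.ShaPrimaryTransfer
import Literature.NumberTheory.EllipticCurves.Curve346NontrivialSha
import HarnessLib

/-!
# Route ShaPrimaryTransfer — THE ISOGENY DOOR AT RANK 2: `t_2(X) = 0` certified for the rank-`2` curve
# `X = [0, −346, 0, 1369, 0]` although `Ш(X/ℚ)[2] ≠ 0` (`#Ш(X/ℚ)[φ] = 4`), and what this says about the crux T

Helper for item stmt-BirchSwinnertonDyer-22356 (`FiniteShaComponentTransfer`, «T»; conjecture-grade at rank `≥ 2`,
unchanged) of route `route-BirchSwinnertonDyer-ShaPrimaryTransfer`. BSD is NOT proved by any of this; T is not proved by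
any of this; no beyond-print theorem is claimed (method: Silverman, *AEC* X.4.9 / X.6.5; a routine curve).

Rank `≥ 2` is where T is open. The cross-prime cells of g8–g10 certify T's HYPOTHESIS `t_2(E) = 0` on rank-`2`/`3` curves by a
SHARP descent on `E` itself (`Ш(E)[2] = 0`). The rank-`0` isogeny door (`…IsogenyDoor`, this seat) certified `t_2 = 0` on a
curve with `Ш[2] ≠ 0`. This file does the same AT RANK `2`, from the Literature files `Curve346*` (this seat):

  `X = [0, −346, 0, 1369, 0]`, `X' = X/⟨(0,0)⟩ = [0, 692, 0, 114240, 0]` (full rational `2`-torsion),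
  `Y = ⟨2, −272, 0, 0⟩ • X' = [0, −31, 0, −2516, 0] : y² = x(x + 37)(x − 68)`, `X ~ Y` over `ℚ`.

* **rank `2`, door at `2` CLOSED on `X` at the first descent, OPEN on the isogenous `Y`**
  (`door_closed_on_X_open_on_Y_rankTwo`): the descent on `Y` is sharp (`rank Y(ℚ) = 2` from `#α(Y(ℚ)) = 16`,
  `S'(−31,−2516) ⊆ {1}`; `Ш(Y/ℚ)[2] = 0`), while on `X` all `64` classes of `S^{(φ)}(X/ℚ) = S(692, 114240)` are everywhere
  locally soluble and only `16` come from `X'(ℚ)`: `#Ш(X/ℚ)[φ] = 4`. Hence `t_2(X) = t_2(Y) = 0` — T's hypothesis at `2` holds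
  on a rank-`2` curve whose own `2`-descent cannot show it.
* **`Ш(X/ℚ)[2^∞]` is FINITE and NON-ZERO with `rank X(ℚ) = 2`** (`finite_nonzero_sha_two_primary_rankTwo`) — the first such
  certificate at rank `≥ 2` in the tree; T reads it as `t_2(X) = 0` and predicts `t_q(X) = 0` for every `q`
  (`transfer_predicts_rankTwo`; CONDITIONAL on T), i.e. `corank_{ℤ_q} Sel_{q^∞}(X/ℚ) = 2` at every prime
  (`selmerCorank_rankTwo_of_transfer`); unconditionally `corank_{ℤ₂} Sel_{2^∞}(X/ℚ) = 2 = rank` (`selmer_column_rankTwo`).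
* O's instance on `X` with witness `2` (`oneFiniteShaComponent_rankTwo`), despite `Ш(X)[2] ≠ 0`.

References: J. H. Silverman, *AEC*, Prop. X.4.9, Thm. X.4.2(a), Prop. X.6.5(b); R. Greenberg, LNM 1716, §1; J. W. S. Cassels,
*Arithmetic on curves of genus 1, VIII*, Crelle 217 (1965).
-/

-- D-0017: single-problem summit, so `Summit.BirchSwinnertonDyer.BirchSwinnertonDyer.…` repeats a namespace BY DESIGN.
set_option linter.dupNamespace false

noncomputable section

namespace Summit.BirchSwinnertonDyer.BirchSwinnertonDyer.Theorems.ShaPrimaryTransferIsogenyDoorRankTwo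

open scoped Classical
open Summit.BirchSwinnertonDyer.BirchSwinnertonDyer.Theses.ShaPrimaryTransfer
  (FiniteShaComponentTransfer OneFiniteShaComponent)
open Literature.NumberTheory.EllipticCurves Literature.NumberTheory.EllipticCurves.Curve346
open WeierstrassCurve

/-! ## §1 The rank-2 isogeny door -/

/-- **The isogeny door at rank `2`.** For `X = [0, −346, 0, 1369, 0]` and the `ℚ`-isogenous `Y : y² = x(x + 37)(x − 68)`:
`X ~ Y`; `rank X(ℚ) = 2`; `Ш(X/ℚ)[2] ≠ 0`; `Ш(Y/ℚ)[2] = 0`; `t_2(X) = 0`. -/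
theorem door_closed_on_X_open_on_Y_rankTwo :
    IsIsogenous (⟨0, -346, 0, 1369, 0⟩ : WeierstrassCurve ℚ) (⟨0, -31, 0, -2516, 0⟩ : WeierstrassCurve ℚ) ∧
      (⟨0, -346, 0, 1369, 0⟩ : WeierstrassCurve ℚ).mordellWeilRank = 2 ∧
      (¬ ∀ c ∈ (⟨0, -346, 0, 1369, 0⟩ : WeierstrassCurve ℚ).sha, 2 • c = 0 → c = 0) ∧
      (∀ c ∈ (⟨0, -31, 0, -2516, 0⟩ : WeierstrassCurve ℚ).sha, 2 • c = 0 → c = 0) ∧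
      (⟨0, -346, 0, 1369, 0⟩ : WeierstrassCurve ℚ).shaCorank 2 = 0 :=
  ⟨isIsogenous_X_Y, mordellWeilRank_X, not_forall_mem_sha_X_two_smul_eq_zero, forall_mem_sha_Y_two_smul_eq_zero,
    shaCorank_X_two⟩

/-- **`Ш(X/ℚ)[2^∞]` finite and non-zero at rank `2`**, with `#Ш(X/ℚ)[φ] = 4`. -/
theorem finite_nonzero_sha_two_primary_rankTwo [(⟨0, -346, 0, 1369, 0⟩ : WeierstrassCurve ℚ).IsElliptic] :
    Finite (AddCommGroup.primaryComponent (⟨0, -346, 0, 1369, 0⟩ : WeierstrassCurve ℚ).sha 2) ∧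
      AddCommGroup.primaryComponent (⟨0, -346, 0, 1369, 0⟩ : WeierstrassCurve ℚ).sha 2 ≠ ⊥ ∧
      (⟨0, -346, 0, 1369, 0⟩ : WeierstrassCurve ℚ).mordellWeilRank = 2 ∧
      Nat.card ↥((⟨0, -346, 0, 1369, 0⟩ : WeierstrassCurve ℚ).sha ⊓
        (⟨0, -346, 0, 1369, 0⟩ : WeierstrassCurve ℚ).twoIsogenyTorsorHom.range) = 4 :=
  ⟨finite_primaryComponent_sha_X_two, primaryComponent_sha_X_two_ne_bot, mordellWeilRank_X, natCard_sha_inf_range_eq⟩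

/-! ## §2 T and O on the rank-2 carrier -/

/-- **O's instance on `X` with witness prime `2`** (unconditional, although `Ш(X/ℚ)[2] ≠ 0`). -/
theorem oneFiniteShaComponent_rankTwo :
    ∃ (p : ℕ) (_ : Fact p.Prime), (⟨0, -346, 0, 1369, 0⟩ : WeierstrassCurve ℚ).shaCorank p = 0 :=
  ⟨2, ⟨Nat.prime_two⟩, shaCorank_X_two⟩

/-- **T predicts `t_q(X) = 0` for every prime `q` on the rank-`2` carrier** from the unconditional `t_2(X) = 0`.
CONDITIONAL on `hT`; unconditional for `q = 2` only; no descent on `X` itself decides any `q`. -/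
theorem transfer_predicts_rankTwo (hT : FiniteShaComponentTransfer) (q : ℕ) [Fact q.Prime] :
    (⟨0, -346, 0, 1369, 0⟩ : WeierstrassCurve ℚ).shaCorank q = 0 := by
  haveI := isElliptic_X
  haveI : Fact (Nat.Prime 2) := ⟨Nat.prime_two⟩
  exact hT _ 2 q shaCorank_X_two

/-- **T in Selmer coordinates on the rank-`2` carrier**: granting T, `corank_{ℤ_q} Sel_{q^∞}(X/ℚ) = 2 = rank X(ℚ)` at every prime
`q` (Greenberg's identity, tree theorem `selmerCorank_eq_mordellWeilRank_add_holds`). CONDITIONAL on `hT`. -/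
theorem selmerCorank_rankTwo_of_transfer (hT : FiniteShaComponentTransfer) (q : ℕ) [Fact q.Prime] :
    (⟨0, -346, 0, 1369, 0⟩ : WeierstrassCurve ℚ).selmerCorank q = 2 := by
  haveI := isElliptic_X
  rw [WeierstrassCurve.selmerCorank_eq_mordellWeilRank_add_holds, mordellWeilRank_X, transfer_predicts_rankTwo hT q]

/-- **The Selmer column at `2`, unconditionally**: `corank_{ℤ₂} Sel_{2^∞}(X/ℚ) = 2 = rank X(ℚ)` while `dim₂ S^{(φ)}(X/ℚ) = 6`
(all `64` classes locally soluble) — the finite `Ш(X/ℚ)[2^∞] ⊇ (ℤ/2ℤ)²` inflates the `2`-Selmer group, not the corank T counts. -/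
theorem selmer_column_rankTwo :
    (⟨0, -346, 0, 1369, 0⟩ : WeierstrassCurve ℚ).selmerCorank 2 = 2 ∧
      (⟨0, -346, 0, 1369, 0⟩ : WeierstrassCurve ℚ).mordellWeilRank = 2 ∧ twoIsogenySelmerRank' (-346) 1369 = 6 :=
  ⟨selmerCorank_X_two, mordellWeilRank_X, twoIsogenySelmerRank'_X⟩

/-- **At rank `2`, «`Ш(E)[2] ≠ 0 ⟹ t_2(E) > 0`» is false as well**: the first descent at `2` not closing on a rank-`2` curve
is no evidence against T's hypothesis there. -/
theorem not_sha_two_torsion_detects_corank_rankTwo :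
    ¬ ∀ (W : WeierstrassCurve ℚ) [W.IsElliptic], W.mordellWeilRank = 2 →
      (∃ c ∈ W.sha, c ≠ 0 ∧ 2 • c = 0) → W.shaCorank 2 ≠ 0 := by
  intro h
  haveI := isElliptic_X
  exact h _ mordellWeilRank_X exists_mem_sha_X_ne_zero_two_smul shaCorank_X_two

end Summit.BirchSwinnertonDyer.BirchSwinnertonDyer.Theorems.ShaPrimaryTransferIsogenyDoorRankTwo

end
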